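import Summits.ValiantsHypothesis.ValiantsHypothesis.Theorems.NewtonFramesTwoProductsFrameRungTwoCube

/-!
# Crux `TwoProducts` (stmt-5906), line `FrameRungTwo`: no block partition of the vertex word (axiom (A2) of the block system of
(IX), with coefficients, NO hypothesis on the frames)

Setting of the shallow-neighbour lemma (IX) (`hIX` of `…FrameRungTwoShallowNeighbour.lean`): two dissociated frames `f`, `g` with
`lexKey`-tops `T`, `T'`, common top, a vertex word `a` of `f` (`Σ a = e`), every point key-above `e` cancelled, `e` itself not.
A BLOCK of the demotion set `J = {j : a j ≠ T j}` is a subset `F ⊆ J` whose total gap `Σ_{j∈F} (T j − a j)` is ONE letter gap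
`T' p − y` of the other frame (colour `p`).  In the block abstraction of (IX) (memo `Cruxes/TwoProducts/memo-IX-blocks.md`, engine
`…FrameRungTwoRainbowBlocks.lean` p609099) axiom (A2) says: `J` has no partition into `≥ 2` blocks of pairwise distinct colours.
In the all-ones design this is just "`e` is not a point of the other sumset"; with coefficients `e` MAY be a word sum of `g`, and (A2)
is the statement proved here:

* `no_block_partition_of_vertex` — a partition of `J` into `≥ 2` blocks with distinct colours contradicts non-cancellation at `e`.

Proof: the blocks give a `g`-word `b'` with `Σ b' = e` (demote `T' (p F)` to `y F` for every block `F`); for each block the corner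
`b^F` (the vertex word promoted outside `F`) is cancelled (`promote_word`, p602840) by the one-letter `g`-word `T'[p F ↦ y F]`, so the
ratio identity `promote_ratio` gives `Π_{j∈F} c(a j)/c(T j) = c'(y F)/c'(T' (p F))`; multiplying over the blocks and using
`Π c'(T') = −Π c(T)` (`topCoeff_add_eq_zero`) yields `Π c'(b') = −Π c(a)`, contradicting `not_word_of_vertex` (p602840).
No genericity, no parallelogram hypothesis, any number of letters.  (The one-block case `F = J` is exactly the case where `e` is a
depth-one word of `g`, which satisfies (IX) trivially.)
Honest scope: one structural lemma for ONE stub of a rung strictly below the crux `TwoProducts`; nothing here bears on `VP ≠ VNP`.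
[ours; setting KPTT arXiv:1308.2286 §2, §5]
-/

set_option linter.dupNamespace false

namespace Summit.ValiantsHypothesis.ValiantsHypothesis.Theorems.NewtonFramesTwoProducts.FrameRungTwoTrinomial

open MvPolynomial
open scoped BigOperators Classical
open Summit.ValiantsHypothesis.Theorems.DissociatedFixedK (lexKey lexKey_injective)
open Summit.ValiantsHypothesis.ValiantsHypothesis.Theorems.DissociatedFixedK.Negative (emb emb_injective)
open Summit.ValiantsHypothesis.ValiantsHypothesis.Theorems.NewtonFramesTwoProducts.FrameRungTwoBinomial
  (emb_add emb_sum apply_le_of_lexKey_le eq_T_of_not_mem_filter ne_T_of_mem_filter coeff_word exists_word prod_coeff_ne_zero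
   topCoeff_add_eq_zero)

noncomputable section

section BlockPartition

variable {m : ℕ}

/-- Gap sum of a corner: promoting the vertex word `a` outside `F` leaves exactly the gaps over `F ∩ J`; when `F ⊆ J` this is
`Σ_{j∈F} (T j − a j)`. -/
theorem emb_sum_corner (T a : Fin m → (Fin 2 →₀ ℕ)) (F : Finset (Fin m)) :
    emb (∑ j, (fun j => if j ∈ F then a j else T j) j) = emb (∑ j, T j) - ∑ j ∈ F, (emb (T j) - emb (a j)) := by
  rw [emb_sum_eq T]
  congr 1
  rw [← Finset.sum_filter_add_sum_filter_not Finset.univ (fun j => j ∈ F)]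
  have h1 : Finset.univ.filter (fun j => j ∈ F) = F := by ext j; simp
  rw [h1]
  have h2 : ∑ j ∈ Finset.univ.filter (fun j => ¬ j ∈ F), (emb (T j) - emb ((fun j => if j ∈ F then a j else T j) j)) = 0 := by
    refine Finset.sum_eq_zero fun j hj => ?_
    rw [Finset.mem_filter] at hj
    simp only [if_neg hj.2, sub_self]
  rw [h2, add_zero]
  refine Finset.sum_congr rfl fun j hj => ?_
  simp only [if_pos hj]

/-- **(A2) with coefficients: the demotion set of an uncancelled vertex word has no partition into `≥ 2` blocks of distinct colours.**
Data of a would-be partition: `P` a family of nonempty pairwise disjoint subsets with union `J = {j : a j ≠ T j}`, `|P| ≥ 2`, an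
injective colouring `p : P → Fin m` and letters `y F ∈ supp (g (p F))` with `Σ_{j∈F} (T j − a j) = T' (p F) − y F`. [ours] -/
theorem no_block_partition_of_vertex (l : (Fin 2 → ℝ) →L[ℝ] ℝ) (f g : Fin m → MvPolynomial (Fin 2) ℂ)
    (T T' : Fin m → (Fin 2 →₀ ℕ))
    (hT : ∀ j, T j ∈ (f j).support) (hTmax : ∀ j, ∀ x ∈ (f j).support, lexKey l x ≤ lexKey l (T j))
    (hT' : ∀ j, T' j ∈ (g j).support)
    (hinjf : ∀ a b : Fin m → (Fin 2 →₀ ℕ), (∀ j, a j ∈ (f j).support) → (∀ j, b j ∈ (f j).support) →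
      ∑ j, a j = ∑ j, b j → a = b)
    (hinjg : ∀ a b : Fin m → (Fin 2 →₀ ℕ), (∀ j, a j ∈ (g j).support) → (∀ j, b j ∈ (g j).support) →
      ∑ j, a j = ∑ j, b j → a = b)
    (e : Fin 2 →₀ ℕ)
    (hzero : ∀ x : Fin 2 →₀ ℕ, x ≠ e → l (emb e) ≤ l (emb x) → coeff x (∏ j, f j) + coeff x (∏ j, g j) = 0)
    (he : coeff e (∏ j, f j) + coeff e (∏ j, g j) ≠ 0)
    (htop : ∑ j, T j = ∑ j, T' j) (hTe : lexKey l e < lexKey l (∑ j, T j))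
    {a : Fin m → (Fin 2 →₀ ℕ)} (ha : ∀ j, a j ∈ (f j).support) (hea : ∑ j, a j = e)
    (P : Finset (Finset (Fin m))) (p : Finset (Fin m) → Fin m) (y : Finset (Fin m) → (Fin 2 →₀ ℕ))
    (hPne : ∀ F ∈ P, F.Nonempty) (hPdisj : ∀ F ∈ P, ∀ F' ∈ P, F ≠ F' → Disjoint F F')
    (hPU : P.biUnion id = Finset.univ.filter fun i => a i ≠ T i) (hP2 : 2 ≤ P.card)
    (hpinj : ∀ F ∈ P, ∀ F' ∈ P, p F = p F' → F = F')
    (hy : ∀ F ∈ P, y F ∈ (g (p F)).support)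
    (hgap : ∀ F ∈ P, ∑ j ∈ F, (emb (T j) - emb (a j)) = emb (T' (p F)) - emb (y F)) : False := by
  have hFJ : ∀ F ∈ P, F ⊆ Finset.univ.filter (fun i => a i ≠ T i) := fun F hF => by
    rw [← hPU]; exact Finset.subset_biUnion_of_mem id hF
  -- Step 1: for every block, the corner promoted outside `F` is the one-letter `g`-word `T'[p F ↦ y F]`, which gives the ratio
  -- identity `Π_{j∈F} c(a j)/c(T j) = c'(y F)/c'(T'(p F))` and `y F ≠ T' (p F)`.
  have hblock : ∀ F ∈ P, y F ≠ T' (p F) ∧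
      ∏ j ∈ F, (coeff (a j) (f j) / coeff (T j) (f j)) = coeff (y F) (g (p F)) / coeff (T' (p F)) (g (p F)) := by
    intro F hF
    set bF : Fin m → (Fin 2 →₀ ℕ) := fun j => if j ∈ F then a j else T j with hbF
    have hb : ∀ j, bF j = a j ∨ bF j = T j := by
      intro j; by_cases hj : j ∈ F
      · left; simp only [hbF, if_pos hj]
      · right; simp only [hbF, if_neg hj]
    -- another block supplies a demoted coordinate outside `F`, so `bF ≠ a`
    obtain ⟨F', hF', hFF'⟩ : ∃ F' ∈ P, F' ≠ F := by
      by_contra hno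
      push Not at hno
      have : P ⊆ {F} := fun G hG => Finset.mem_singleton.2 (hno G hG)
      have := Finset.card_le_card this
      rw [Finset.card_singleton] at this
      omega
    obtain ⟨j₁, hj₁⟩ := hPne F' hF'
    have hj₁F : j₁ ∉ F := fun h => Finset.disjoint_left.1 (hPdisj F' hF' F hF hFF') hj₁ h
    have hj₁J : a j₁ ≠ T j₁ := ne_T_of_mem_filter T (hFJ F' hF' hj₁)
    have hne : bF ≠ a := by
      intro h
      have := congrFun h j₁
      simp only [hbF, if_neg hj₁F] at this
      exact hj₁J this.symm
    obtain ⟨cF, hcF, hsum, hprod⟩ := promote_word l f g T hT hTmax hinjf hinjg e hzero ha hea hb hne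
    -- the corner sum
    have hcorner : emb (∑ j, bF j) = emb (∑ j, T' j) - (emb (T' (p F)) - emb (y F)) := by
      rw [hbF, emb_sum_corner T a F, hgap F hF, htop]
    -- `cF` is the one-letter demotion `T'[p F ↦ y F]`
    have hupd_mem : ∀ i, Function.update T' (p F) (y F) i ∈ (g i).support := by
      intro i
      rcases eq_or_ne i (p F) with rfl | hi
      · rw [Function.update_self]; exact hy F hF
      · rw [Function.update_of_ne hi]; exact hT' i
    have hcF_eq : cF = Function.update T' (p F) (y F) := by
      apply hinjg _ _ hcF hupd_mem
      apply emb_injective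
      rw [hsum, hcorner, emb_sum_update T' (p F) (y F)]
    have hyT : y F ≠ T' (p F) := by
      intro hyT
      have hcT : cF = T' := by rw [hcF_eq, hyT, Function.update_eq_self]
      have hbT : bF = T := by
        apply hinjf _ _ (promote_mem f T hT ha hb) hT
        rw [← hsum, hcT, htop]
      -- `bF = T` forces `a j = T j` on the nonempty block `F ⊆ J`
      obtain ⟨j₀, hj₀⟩ := hPne F hF
      have h0 := congrFun hbT j₀
      simp only [hbF, if_pos hj₀] at h0
      exact ne_T_of_mem_filter T (hFJ F hF hj₀) h0
    have hratio := promote_ratio l f g T T' hT hT' hinjf hinjg e hzero htop hTe hprod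
    -- left filter = `F`, right filter = `{p F}`
    have hfilt_b : Finset.univ.filter (fun i => bF i ≠ T i) = F := by
      ext j
      simp only [Finset.mem_filter, Finset.mem_univ, true_and, hbF]
      constructor
      · intro h
        by_contra hj
        rw [if_neg hj] at h
        exact h rfl
      · intro hj
        rw [if_pos hj]
        exact ne_T_of_mem_filter T (hFJ F hF hj)
    have hfilt_c : Finset.univ.filter (fun i => cF i ≠ T' i) = {p F} := by
      ext i
      simp only [Finset.mem_filter, Finset.mem_univ, true_and, Finset.mem_singleton, hcF_eq]
      constructor
      · intro h
        by_contra hi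
        rw [Function.update_of_ne hi] at h
        exact h rfl
      · intro hi
        rw [hi, Function.update_self]
        exact hyT
    rw [hfilt_b, hfilt_c, Finset.prod_singleton, hcF_eq, Function.update_self] at hratio
    refine ⟨hyT, ?_⟩
    rw [← hratio]
    refine Finset.prod_congr rfl fun j hj => ?_
    simp only [hbF, if_pos hj]
  -- Step 2: the `g`-word `b'` of the whole partition
  have huniq : ∀ i, (∃ F ∈ P, p F = i) → ∃! F, F ∈ P ∧ p F = i := by
    rintro i ⟨F, hF, hpF⟩
    exact ⟨F, ⟨hF, hpF⟩, fun F' ⟨hF', hpF'⟩ => hpinj F' hF' F hF (hpF'.trans hpF.symm)⟩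
  set b' : Fin m → (Fin 2 →₀ ℕ) := fun i =>
    if h : ∃ F ∈ P, p F = i then y (Finset.choose (fun F => p F = i) P (huniq i h)) else T' i with hb'
  -- on colours of blocks `b'` is the block letter, elsewhere the top
  have hb'_col : ∀ F ∈ P, b' (p F) = y F := by
    intro F hF
    have h : ∃ F' ∈ P, p F' = p F := ⟨F, hF, rfl⟩
    have hspec := Finset.choose_spec (fun F' => p F' = p F) P (huniq (p F) h)
    have hch : Finset.choose (fun F' => p F' = p F) P (huniq (p F) h) = F := hpinj _ hspec.1 F hF hspec.2
    simp only [hb', dif_pos h]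
    rw [hch]
  have hb'_off : ∀ i, (¬ ∃ F ∈ P, p F = i) → b' i = T' i := by
    intro i h
    simp only [hb', dif_neg h]
  have hb'mem : ∀ i, b' i ∈ (g i).support := by
    intro i
    by_cases h : ∃ F ∈ P, p F = i
    · obtain ⟨F, hF, rfl⟩ := h
      rw [hb'_col F hF]; exact hy F hF
    · rw [hb'_off i h]; exact hT' i
  have hfilt' : Finset.univ.filter (fun i => b' i ≠ T' i) = P.image p := by
    ext i
    simp only [Finset.mem_filter, Finset.mem_univ, true_and, Finset.mem_image]
    constructor
    · intro h
      by_contra hno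
      push Not at hno
      exact h (hb'_off i fun ⟨F, hF, hpF⟩ => hno F hF hpF)
    · rintro ⟨F, hF, rfl⟩
      rw [hb'_col F hF]
      exact (hblock F hF).1
  -- the sum of `b'` is `e`
  have hsum' : ∑ i, b' i = e := by
    apply emb_injective
    rw [emb_sum_eq T' b', sum_gap_eq_sum_filter T' b', hfilt', Finset.sum_image fun F hF F' hF' h => hpinj F hF F' hF' h]
    have h1 : ∑ F ∈ P, (emb (T' (p F)) - emb (b' (p F))) = ∑ F ∈ P, ∑ j ∈ F, (emb (T j) - emb (a j)) := by
      refine Finset.sum_congr rfl fun F hF => ?_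
      rw [hb'_col F hF, hgap F hF]
    have hdisj' : (P : Set (Finset (Fin m))).PairwiseDisjoint id := by
      intro F hF F' hF' hFF'
      exact hPdisj F hF F' hF' hFF'
    have hsumU : ∑ F ∈ P, ∑ j ∈ F, (emb (T j) - emb (a j)) =
        ∑ j ∈ Finset.univ.filter (fun i => a i ≠ T i), (emb (T j) - emb (a j)) := by
      rw [← hPU, Finset.sum_biUnion hdisj']
      rfl
    rw [h1, hsumU, ← sum_gap_eq_sum_filter T a, ← htop, ← emb_sum_eq T a, hea]
  -- Step 3: the coefficient of `b'` is minus that of `a`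
  have hA0 : ∏ j, coeff (T j) (f j) ≠ 0 := prod_coeff_ne_zero f _ hT
  have htc := topCoeff_add_eq_zero l f g T T' hT hT' hinjf hinjg e hzero htop hTe
  have hB : ∏ j, coeff (T' j) (g j) = -∏ j, coeff (T j) (f j) := eq_neg_of_add_eq_zero_right htc
  have hdisj' : (P : Set (Finset (Fin m))).PairwiseDisjoint id := by
    intro F hF F' hF' hFF'
    exact hPdisj F hF F' hF' hFF'
  have hratio_all : ∏ i ∈ Finset.univ.filter (fun i => b' i ≠ T' i), (coeff (b' i) (g i) / coeff (T' i) (g i)) =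
      ∏ j ∈ Finset.univ.filter (fun i => a i ≠ T i), (coeff (a j) (f j) / coeff (T j) (f j)) := by
    rw [hfilt', Finset.prod_image fun F hF F' hF' h => hpinj F hF F' hF' h, ← hPU, Finset.prod_biUnion hdisj']
    refine Finset.prod_congr rfl fun F hF => ?_
    rw [hb'_col F hF, ← (hblock F hF).2]
    rfl
  have hcoef : ∏ i, coeff (b' i) (g i) = -∏ j, coeff (a j) (f j) := by
    rw [prod_coeff_ratio g T' hT' b', prod_coeff_ratio f T hT a, hratio_all, hB, neg_mul]
  exact not_word_of_vertex f g hinjf hinjg e he ha hea hb'mem hsum' hcoef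

end BlockPartition

end

end Summit.ValiantsHypothesis.ValiantsHypothesis.Theorems.NewtonFramesTwoProducts.FrameRungTwoTrinomial
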